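import Summits.Ventures.PackingBounds.ThreePointCert.K5Cert

/-!
# κ(5) ≤ 45 (three-point bound, kernel-checked): kernel validation of Gram block R1 (chunks 1–6 of 6)

Framing: lottery ticket; floor = certified bounds/negative ranges. Venture `PackingBounds` (cell
`pub-packcert`), three-point SDP family. Integer data of a feasible point of the Bachoc–Vallentin
semidefinite program (n = 5, s = 1/2, degree d = 8, symmetric
sums of squares), derived by `pub-packcert-sdp/code/cert2lean.py` from the exact rational
certificate `sdp-n5-d8-s1-2-sym.json` of the cell (two independent exact verifiers + referee), in the
units of the kernel checker `ThreePointCert.Check` (soundness `ThreePointCert.Sound`). Generated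
file: plain lists of integers / monomials.
-/

namespace Summit.Ventures.PackingBounds.ThreePointCert.K5

open Literature.Geometry.DiscreteGeometry Literature.Geometry.DiscreteGeometry.PolyCert PolyCert.SPoly

set_option maxHeartbeats 0 in
/-- Block `R1`: rows from 0 (42 rows) of `zᵀ(LLᵀ)z` added to `[]` give `dR1c1` (kernel). -/
theorem okR1_1 : chunkOK gR1 0 42 [] dR1c1 = true := by
  decide +kernel

set_option maxHeartbeats 0 in
/-- Block `R1`: rows from 42 (20 rows) of `zᵀ(LLᵀ)z` added to `dR1c1` give `dR1c2` (kernel). -/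
theorem okR1_2 : chunkOK gR1 42 20 dR1c1 dR1c2 = true := by
  decide +kernel

set_option maxHeartbeats 0 in
/-- Block `R1`: rows from 62 (16 rows) of `zᵀ(LLᵀ)z` added to `dR1c2` give `dR1c3` (kernel). -/
theorem okR1_3 : chunkOK gR1 62 16 dR1c2 dR1c3 = true := by
  decide +kernel

set_option maxHeartbeats 0 in
/-- Block `R1`: rows from 78 (15 rows) of `zᵀ(LLᵀ)z` added to `dR1c3` give `dR1c4` (kernel). -/
theorem okR1_4 : chunkOK gR1 78 15 dR1c3 dR1c4 = true := by
  decide +kernel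

set_option maxHeartbeats 0 in
/-- Block `R1`: rows from 93 (14 rows) of `zᵀ(LLᵀ)z` added to `dR1c4` give `dR1c5` (kernel). -/
theorem okR1_5 : chunkOK gR1 93 14 dR1c4 dR1c5 = true := by
  decide +kernel

set_option maxHeartbeats 0 in
/-- Block `R1`: rows from 107 ((gR1.z.length - 107) rows) of `zᵀ(LLᵀ)z` added to `dR1c5` give `eR1` (kernel). -/
theorem okR1_6 : chunkOK gR1 107 (gR1.z.length - 107) dR1c5 eR1 = true := by
  decide +kernel

end Summit.Ventures.PackingBounds.ThreePointCert.K5
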